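import Summits.QuantumFields.YangMills.Theorems.HyperbolicRegulatorHyperbolicToTorusDefs

/-!
# Route `HyperbolicRegulator`, crux `HyperbolicToTorus` (stmt-QuantumFields-15827), line `no_admissible_complex` (v3):
# stub `stub_chart` — the vertex chart at a flat vertex of an admissible complex is an abstract `IsChart`

For an admissible finite square complex (`Adm`, nine axioms) and a flat vertex `x`, the vertex chart
`cV x : ℤ² → ℕ` of sup-radius `R = k/4` given by axiom 9 is an abstract chart
`IsChart (graphOf E σ τ) R (cV x)`:
* it is injective on the box — axiom 9 verbatim (`Adm.chart_injOn`);
* lattice neighbours inside the box are adjacent — the chart edge `cE x a μ` of axiom 9 (`Adm.chart_edge`) is an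
  edge of `E` with endpoint pair `{cV x a, cV x (a + e_μ)}`, and edges have distinct endpoints (axiom 1, `Adm.edges`);
* interior points are certified — an interior chart point `v = cV x a` (`InBox (R - 1) a`) has degree `4`
  (axiom 4: degree `4` or `5`; not `5` by `Adm.degOf_chart_ne_five`, i.e. the landed
  `Negative.card_edgesAt_ne_five_of_boxChart`), its four chart edges are pairwise distinct edges at `v` (injectivity
  of the chart), so they are ALL the edges at `v`, and every neighbour `w` of `v` is the other endpoint of one of
  them, i.e. the image of a lattice neighbour of `a`.

The combinatorics is folklore (square complexes / combinatorial curvature); no published theorem is restated.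
-/

set_option autoImplicit false

namespace Summit.QuantumFields.YangMills.Cruxes.HyperbolicToTorus.NoAdmissibleComplex

open Finset Summit.QuantumFields.YangMills.Theorems.HyperbolicToTorus.Negative

namespace StubChart

section Graph

variable {E : Finset ℕ} {σ τ : ℕ → ℕ}

/-- Adjacency in `graphOf E σ τ` via endpoint pairs: `p ~ q` iff `p ≠ q` and some edge of `E` has endpoint
pair `{p, q}`. -/
theorem adj_iff_pair {p q : ℕ} :
    (graphOf E σ τ).Adj p q ↔ p ≠ q ∧ ∃ e ∈ E, ({σ e, τ e} : Finset ℕ) = {p, q} := by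
  rw [graphOf_adj]
  refine ⟨fun ⟨hne, h⟩ => ⟨hne, ?_⟩, fun ⟨hne, e, he, hpair⟩ => ⟨hne, ?_⟩⟩
  · rcases h with ⟨e, he, hs, ht⟩ | ⟨e, he, hs, ht⟩
    · exact ⟨e, he, by rw [hs, ht]⟩
    · exact ⟨e, he, by rw [hs, ht, pair_comm]⟩
  · have hp : p ∈ ({σ e, τ e} : Finset ℕ) := by rw [hpair]; exact mem_insert_self _ _
    have hq : q ∈ ({σ e, τ e} : Finset ℕ) := by rw [hpair]; exact mem_insert_of_mem (mem_singleton_self _)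
    simp only [mem_insert, mem_singleton] at hp hq
    rcases hp with hp | hp
    · rcases hq with hq | hq
      · exact absurd (hp.trans hq.symm) hne
      · exact Or.inl ⟨e, he, hp.symm, hq.symm⟩
    · rcases hq with hq | hq
      · exact Or.inr ⟨e, he, hq.symm, hp.symm⟩
      · exact absurd (hp.trans hq.symm) hne

/-- The edges at `v` in the sense of `degOf` (`σ e = v ∨ τ e = v`) are the edges whose endpoint pair contains `v`. -/
theorem mem_edgesAt {v e : ℕ} :
    e ∈ E.filter (fun e => σ e = v ∨ τ e = v) ↔ e ∈ E ∧ v ∈ ({σ e, τ e} : Finset ℕ) := by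
  rw [mem_filter, mem_endpair_iff]

/-- Two edges with endpoint pairs `{v, b}` and `{v, c}`, where `b ≠ v` and `b ≠ c`, are different edges. -/
theorem ne_of_pairs {f g v b c : ℕ} (hf : ({σ f, τ f} : Finset ℕ) = {v, b})
    (hg : ({σ g, τ g} : Finset ℕ) = {v, c}) (hb : b ≠ v) (hbc : b ≠ c) : f ≠ g := by
  intro heq
  apply hbc
  apply pair_eq_pair_left hb
  rw [← hf, ← hg, heq]

end Graph

/-- Four pairwise distinct members of a finset with at most four elements exhaust it. -/
theorem eq_or_of_card_le_four {S : Finset ℕ} {f₁ f₂ f₃ f₄ e : ℕ} (hS : S.card ≤ 4)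
    (h₁ : f₁ ∈ S) (h₂ : f₂ ∈ S) (h₃ : f₃ ∈ S) (h₄ : f₄ ∈ S)
    (h₁₂ : f₁ ≠ f₂) (h₁₃ : f₁ ≠ f₃) (h₁₄ : f₁ ≠ f₄) (h₂₃ : f₂ ≠ f₃) (h₂₄ : f₂ ≠ f₄) (h₃₄ : f₃ ≠ f₄)
    (he : e ∈ S) : e = f₁ ∨ e = f₂ ∨ e = f₃ ∨ e = f₄ := by
  have hsub : ({f₁, f₂, f₃, f₄} : Finset ℕ) ⊆ S := by
    intro f hf
    simp only [mem_insert, mem_singleton] at hf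
    rcases hf with rfl | rfl | rfl | rfl <;> assumption
  have hcard : ({f₁, f₂, f₃, f₄} : Finset ℕ).card = 4 := by
    rw [card_insert_of_notMem (by simp [h₁₂, h₁₃, h₁₄]), card_insert_of_notMem (by simp [h₂₃, h₂₄]),
      card_insert_of_notMem (by simp [h₃₄]), card_singleton]
  have heq : ({f₁, f₂, f₃, f₄} : Finset ℕ) = S := eq_of_subset_of_card_le hsub (by rw [hcard]; exact hS)
  rw [← heq] at he
  simpa only [mem_insert, mem_singleton] using he

/-- The ten inequalities between a lattice point and its four lattice neighbours. -/
theorem nbr_ne (a : ℤ × ℤ) :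
    (a.1 + 1, a.2) ≠ a ∧ (a.1, a.2 + 1) ≠ a ∧ (a.1 - 1, a.2) ≠ a ∧ (a.1, a.2 - 1) ≠ a ∧
    (a.1 + 1, a.2) ≠ (a.1, a.2 + 1) ∧ (a.1 + 1, a.2) ≠ (a.1 - 1, a.2) ∧ (a.1 + 1, a.2) ≠ (a.1, a.2 - 1) ∧
    (a.1, a.2 + 1) ≠ (a.1 - 1, a.2) ∧ (a.1, a.2 + 1) ≠ (a.1, a.2 - 1) ∧ (a.1 - 1, a.2) ≠ (a.1, a.2 - 1) := by
  obtain ⟨p, q⟩ := a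
  simp only [ne_eq, Prod.mk.injEq, not_and]
  omega

/-- The four lattice neighbours of an interior point of the box of radius `R` lie in the box. -/
theorem inBox_of_unitStep {R : ℤ} {a b : ℤ × ℤ} (ha : InBox (R - 1) a) (hab : UnitStep a b) : InBox R b := by
  obtain ⟨h1, h2⟩ := ha
  rw [abs_le] at h1 h2
  rcases hab with rfl | rfl | rfl | rfl <;> simp only [InBox, abs_le] <;> omega

/-- An interior point of the box lies in the box. -/
theorem inBox_of_interior {R : ℤ} {a : ℤ × ℤ} (ha : InBox (R - 1) a) : InBox R a :=
  ⟨ha.1.trans (by omega), ha.2.trans (by omega)⟩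

section Chart

variable {k j : ℕ} {V E Q : Finset ℕ} {σ τ : ℕ → ℕ} {bd : ℕ → Fin 4 → ℕ × Bool} {cV : ℕ → ℤ × ℤ → ℕ}
  {cE : ℕ → ℤ × ℤ → Fin 2 → ℕ × Bool} {x : ℕ}

/-- The horizontal chart edge `cE x a 0` from `a` to `(a.1+1, a.2)` (axiom 9): an edge of `E` with endpoint pair
`{cV x a, cV x (a.1+1, a.2)}`, whatever its orientation flag. -/
theorem edge_right (hA : Adm k j V E Q σ τ bd cV cE) (hx : IsFlatAt k V E σ τ x) {a : ℤ × ℤ}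
    (ha : InBox ((k : ℤ) / 4) a) (hb : InBox ((k : ℤ) / 4) (a.1 + 1, a.2)) :
    (cE x a 0).1 ∈ E ∧
      ({σ (cE x a 0).1, τ (cE x a 0).1} : Finset ℕ) = {cV x a, cV x (a.1 + 1, a.2)} := by
  obtain ⟨hE, hs, he⟩ := hA.chart_edge hx a 0 ha (by simpa using hb)
  rw [if_pos (show (0 : Fin 2) = 0 from rfl)] at he
  refine ⟨hE, ?_⟩
  by_cases h : (cE x a 0).2 = true
  · rw [if_pos h] at hs he
    rw [hs, he]
  · rw [if_neg h] at hs he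
    rw [hs, he, pair_comm]

/-- The vertical chart edge `cE x a 1` from `a` to `(a.1, a.2+1)` (axiom 9): an edge of `E` with endpoint pair
`{cV x a, cV x (a.1, a.2+1)}`, whatever its orientation flag. -/
theorem edge_up (hA : Adm k j V E Q σ τ bd cV cE) (hx : IsFlatAt k V E σ τ x) {a : ℤ × ℤ}
    (ha : InBox ((k : ℤ) / 4) a) (hb : InBox ((k : ℤ) / 4) (a.1, a.2 + 1)) :
    (cE x a 1).1 ∈ E ∧
      ({σ (cE x a 1).1, τ (cE x a 1).1} : Finset ℕ) = {cV x a, cV x (a.1, a.2 + 1)} := by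
  obtain ⟨hE, hs, he⟩ := hA.chart_edge hx a 1 ha (by simpa using hb)
  rw [if_neg (show (1 : Fin 2) ≠ 0 by decide)] at he
  refine ⟨hE, ?_⟩
  by_cases h : (cE x a 1).2 = true
  · rw [if_pos h] at hs he
    rw [hs, he]
  · rw [if_neg h] at hs he
    rw [hs, he, pair_comm]

/-- An edge of `E` with endpoint pair `{p, q}` makes `p` and `q` adjacent in `graphOf E σ τ` (edges of an
admissible complex have distinct endpoints, axiom 1). -/
theorem adj_of_edge (hA : Adm k j V E Q σ τ bd cV cE) {e p q : ℕ} (he : e ∈ E)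
    (hpq : ({σ e, τ e} : Finset ℕ) = {p, q}) : (graphOf E σ τ).Adj p q := by
  refine adj_iff_pair.2 ⟨?_, e, he, hpq⟩
  rintro rfl
  have hσ : σ e ∈ ({p, p} : Finset ℕ) := hpq ▸ mem_insert_self _ _
  have hτ : τ e ∈ ({p, p} : Finset ℕ) := hpq ▸ mem_insert_of_mem (mem_singleton_self _)
  simp only [mem_insert, mem_singleton, or_self] at hσ hτ
  exact (hA.edges e he).2.2 (hσ.trans hτ.symm)

/-- **Second clause of `IsChart`**: lattice neighbours inside the box are adjacent. The two positive directions are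
the chart edges at `a`; the two negative directions are the chart edges at the neighbour, reversed. -/
theorem adj_of_unitStep (hA : Adm k j V E Q σ τ bd cV cE) (hx : IsFlatAt k V E σ τ x) {a b : ℤ × ℤ}
    (ha : InBox ((k : ℤ) / 4) a) (hb : InBox ((k : ℤ) / 4) b) (hab : UnitStep a b) :
    (graphOf E σ τ).Adj (cV x a) (cV x b) := by
  rcases hab with rfl | rfl | rfl | rfl
  · obtain ⟨hE, hp⟩ := edge_right hA hx ha hb
    exact adj_of_edge hA hE hp
  · have e : ((a.1 - 1, a.2).1 + 1, (a.1 - 1, a.2).2) = a := by ext <;> simp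
    have hb' : InBox ((k : ℤ) / 4) ((a.1 - 1, a.2).1 + 1, (a.1 - 1, a.2).2) := by rw [e]; exact ha
    obtain ⟨hE, hp⟩ := edge_right hA hx hb hb'
    rw [e] at hp
    exact (adj_of_edge hA hE hp).symm
  · obtain ⟨hE, hp⟩ := edge_up hA hx ha hb
    exact adj_of_edge hA hE hp
  · have e : ((a.1, a.2 - 1).1, (a.1, a.2 - 1).2 + 1) = a := by ext <;> simp
    have hb' : InBox ((k : ℤ) / 4) ((a.1, a.2 - 1).1, (a.1, a.2 - 1).2 + 1) := by rw [e]; exact ha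
    obtain ⟨hE, hp⟩ := edge_up hA hx hb hb'
    rw [e] at hp
    exact (adj_of_edge hA hE hp).symm

/-- **Third clause of `IsChart`**: interior points are certified. For `a` in the box of radius `R - 1`, the chart
point `v = cV x a` is a vertex of degree `4` (`Adm.degree`, `Adm.degOf_chart_ne_five`); its four chart edges (to
the right/up from `a`, and from the left/lower neighbour to `a`) are pairwise distinct edges at `v`, hence they are
all the edges at `v`, and a neighbour `w` of `v` is the far endpoint of one of them. -/
theorem certified (hA : Adm k j V E Q σ τ bd cV cE) (hx : IsFlatAt k V E σ τ x) {a : ℤ × ℤ}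
    (ha : InBox ((k : ℤ) / 4 - 1) a) {w : ℕ} (hw : (graphOf E σ τ).Adj (cV x a) w) :
    ∃ b : ℤ × ℤ, UnitStep a b ∧ w = cV x b := by
  -- box memberships of `a` and of its four lattice neighbours
  have ha' : InBox ((k : ℤ) / 4) a := inBox_of_interior ha
  have hbR : InBox ((k : ℤ) / 4) (a.1 + 1, a.2) := inBox_of_unitStep ha (Or.inl rfl)
  have hbL : InBox ((k : ℤ) / 4) (a.1 - 1, a.2) := inBox_of_unitStep ha (Or.inr (Or.inl rfl))
  have hbU : InBox ((k : ℤ) / 4) (a.1, a.2 + 1) := inBox_of_unitStep ha (Or.inr (Or.inr (Or.inl rfl)))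
  have hbD : InBox ((k : ℤ) / 4) (a.1, a.2 - 1) := inBox_of_unitStep ha (Or.inr (Or.inr (Or.inr rfl)))
  -- the four chart edges at `a`: right, up (based at `a`), left, down (based at the neighbour)
  obtain ⟨hRE, hRp⟩ := edge_right hA hx ha' hbR
  obtain ⟨hUE, hUp⟩ := edge_up hA hx ha' hbU
  have eL : ((a.1 - 1, a.2).1 + 1, (a.1 - 1, a.2).2) = a := by ext <;> simp
  have hbL' : InBox ((k : ℤ) / 4) ((a.1 - 1, a.2).1 + 1, (a.1 - 1, a.2).2) := by rw [eL]; exact ha'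
  obtain ⟨hLE, hLp⟩ := edge_right hA hx hbL hbL'
  rw [eL] at hLp
  have hLp' : ({σ (cE x (a.1 - 1, a.2) 0).1, τ (cE x (a.1 - 1, a.2) 0).1} : Finset ℕ) =
      {cV x a, cV x (a.1 - 1, a.2)} := hLp.trans (pair_comm _ _)
  have eD : ((a.1, a.2 - 1).1, (a.1, a.2 - 1).2 + 1) = a := by ext <;> simp
  have hbD' : InBox ((k : ℤ) / 4) ((a.1, a.2 - 1).1, (a.1, a.2 - 1).2 + 1) := by rw [eD]; exact ha'
  obtain ⟨hDE, hDp⟩ := edge_up hA hx hbD hbD'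
  rw [eD] at hDp
  have hDp' : ({σ (cE x (a.1, a.2 - 1) 1).1, τ (cE x (a.1, a.2 - 1) 1).1} : Finset ℕ) =
      {cV x a, cV x (a.1, a.2 - 1)} := hDp.trans (pair_comm _ _)
  -- `v = cV x a` is a vertex with at most four edges
  have hv : cV x a ∈ V := hA.chart_mem hx a ha'
  have h4 : (E.filter fun e => σ e = cV x a ∨ τ e = cV x a).card ≤ 4 := by
    have h := (hA.degree _ hv).1
    have h5 := hA.degOf_chart_ne_five hx ha
    unfold degOf at h h5
    omega
  -- distinct chart points
  have hne : ∀ {p q : ℤ × ℤ}, InBox ((k : ℤ) / 4) p → InBox ((k : ℤ) / 4) q → p ≠ q → cV x p ≠ cV x q :=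
    fun hp hq hpq h => hpq (hA.chart_injOn hx hp hq h)
  obtain ⟨nRa, nUa, nLa, nDa, nRU, nRL, nRD, nUL, nUD, nLD⟩ := nbr_ne a
  have vR : cV x (a.1 + 1, a.2) ≠ cV x a := hne hbR ha' nRa
  have vU : cV x (a.1, a.2 + 1) ≠ cV x a := hne hbU ha' nUa
  have vL : cV x (a.1 - 1, a.2) ≠ cV x a := hne hbL ha' nLa
  -- the four chart edges are pairwise distinct
  have dRU := ne_of_pairs hRp hUp vR (hne hbR hbU nRU)
  have dRL := ne_of_pairs hRp hLp' vR (hne hbR hbL nRL)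
  have dRD := ne_of_pairs hRp hDp' vR (hne hbR hbD nRD)
  have dUL := ne_of_pairs hUp hLp' vU (hne hbU hbL nUL)
  have dUD := ne_of_pairs hUp hDp' vU (hne hbU hbD nUD)
  have dLD := ne_of_pairs hLp' hDp' vL (hne hbL hbD nLD)
  -- they are edges at `v`, and so is the edge `e` carrying `w`
  have mem : ∀ {f c : ℕ}, f ∈ E → ({σ f, τ f} : Finset ℕ) = {cV x a, c} →
      f ∈ E.filter (fun e => σ e = cV x a ∨ τ e = cV x a) :=
    fun hf hp => mem_edgesAt.2 ⟨hf, by rw [hp]; exact mem_insert_self _ _⟩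
  obtain ⟨hvw, e, heE, hep⟩ := adj_iff_pair.1 hw
  have he4 := eq_or_of_card_le_four h4 (mem hRE hRp) (mem hUE hUp) (mem hLE hLp') (mem hDE hDp')
    dRU dRL dRD dUL dUD dLD (mem heE hep)
  -- hence `e` is one of the four, and `w` is its far endpoint
  have key : ∀ {f : ℕ} {b : ℤ × ℤ}, ({σ f, τ f} : Finset ℕ) = {cV x a, cV x b} → e = f → UnitStep a b →
      ∃ b : ℤ × ℤ, UnitStep a b ∧ w = cV x b := by
    rintro f b hf rfl hab
    exact ⟨b, hab, pair_eq_pair_left hvw.symm (hep.symm.trans hf)⟩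
  rcases he4 with h | h | h | h
  · exact key hRp h (Or.inl rfl)
  · exact key hUp h (Or.inr (Or.inr (Or.inl rfl)))
  · exact key hLp' h (Or.inr (Or.inl rfl))
  · exact key hDp' h (Or.inr (Or.inr (Or.inr rfl)))

end Chart

end StubChart

/-- **Registered stub CHART** of the skeleton `Lines/no_admissible_complex.lean` v3: at a flat vertex `x` of an
admissible complex the vertex chart `cV x` of axiom 9 is an `IsChart` of radius `k/4` of `graphOf E σ τ` —
injective on the box (axiom 9), lattice neighbours adjacent (`StubChart.adj_of_unitStep`: chart edges, axiom 1),
interior points certified (`StubChart.certified`: degree `4` by `Adm.degOf_chart_ne_five` and axiom 4, and the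
four distinct chart edges exhaust the edges at the point). -/
theorem stub_chart :
    ∀ (k j : ℕ) (V E Q : Finset ℕ) (σ τ : ℕ → ℕ) (bd : ℕ → Fin 4 → ℕ × Bool) (cV : ℕ → ℤ × ℤ → ℕ) (cE : ℕ → ℤ × ℤ → Fin 2 → ℕ × Bool), 8 ≤ k → Adm k j V E Q σ τ bd cV cE → ∀ x : ℕ, IsFlatAt k V E σ τ x → IsChart (graphOf E σ τ) ((k : ℤ) / 4) (cV x) := by
  intro k j V E Q σ τ bd cV cE _ hA x hx
  exact ⟨hA.chart_injOn hx, fun a b ha hb hab => StubChart.adj_of_unitStep hA hx ha hb hab,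
    fun a ha w hw => StubChart.certified hA hx ha hw⟩

end Summit.QuantumFields.YangMills.Cruxes.HyperbolicToTorus.NoAdmissibleComplex
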